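import Summits.QuantumFields.YangMills.Theorems.BalabanUVNodesK0V23Stub3RunBoxEquivalence
import Literature.MathematicalPhysics.QuantumFieldTheory.Balaban1983to89.Node00.U3OfKernelsChi
import Literature.MathematicalPhysics.QuantumFieldTheory.Balaban1983to89.Node00.Record13NumericsOfThm1CCMWZBChi

/-!
# K0ᴬ (stmt-QuantumFields-27238 `Record13SepCoPHInhabitedAx`) — RUNS ⟹ BOX AT THE RE-CENTRED RECORD, modulo the K3∕N22 kernel letters (H3.3 Ax edition of `…K0V23Stub3RunBoxEquivalence`
# §3–§4): the run-wise core (dag-n07-w3's currency, Ax) and N22's history-Lipschitz road at the RE-CENTRED print-regime Z3 members give back the BOX core of the REGISTERED V24 stub-3ᴬ′ᴮ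
# text and the door boxes — so under the kernel letters the Ax run socket (lens-1 ∕ P3 ∕ `…RunwiseSuppliersAx` roads) and the Ax box socket (V24 stub 3ᴬ′ᴮ) are ONE debt

Cell `pub-ymgap` (YM-PLAN Track A, D-0062), width seat `pub-ymgap-dag-n07-w3` (g23; helper strictly BELOW the registered |β|-box stub).  `--kind proof --supports stmt-QuantumFields-27238
--as helper` (K0ᴬ), COUNT-NEUTRAL.  NEW leaf; theorems only — 0 `def`, 0 `sorry`, 0 `instance`, 0 `notation`; standard axioms.  σ-IMAGE of k0-s1-w3 g9's ✓`…K0V23Stub3RunBoxEquivalence`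
§3–§4 (body-freeze: nothing of it edited; its GENERIC §1–§2 rows `exists_inInterval_genSeq_of_runAbsBound` ∕ `absBetaBox_of_runAbsBound_of_histLipschitz` and §5's sharpness witness
`exists_hbeta_runAbs_not_box` are used ∕ cited BY NAME — the latter is centre-free and needs no edition) under director-ym №467 (D)'s substitution (`betaOfRecord₁₃ ↦ betaOfRecord₁₃Ax`,
`theta13OfThm1CCMWZB ↦ theta13OfThm1CCMWZBAx`, node-U3 objects ∕ (5.10) clause `↦ objectsOfRecord₁₃Ax ∕ KernelDecayOfRecord₁₃Ax` of ✓p802930 `Node00/U3OfKernelsChi`); dag-n22-w3's CENTRED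
`histLipschitz_betaOfRecord₁₃_of_kernelNE9` is replaced by its GENERIC parent `histLipschitz_betaOfMerged_of_ne9` (`…N22KernelsBetaHistLipschitz`) at the re-centred term family (the Ax β
unfolds to `betaOfMerged (betaMerged …χAx…) …` by `rfl`, `Record13Ax.betaOfRecord₁₃Ax_eq_betaOfRecord₈Tχ`); one private centre-free helper re-homed verbatim (№366 R2).
[I] = [Balaban1987RG1]; [RG2] = [Balaban1988RG2Cluster]; [III] = [Balaban1988Convergent].

CONTENTS.  §1 `absBetaBox_betaOfRecord₁₃Ax_of_runAbs_of_histLipschitz` ((iii₀): run letter + node U2's history moduli with fading memory ⟹ box), ★★ `absBetaBox_betaOfRecord₁₃Ax_of_runAbs_of_kernelNE9`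
((iii): run letter + N22's kernel NE9 of `(objectsOfRecord₁₃Ax θ ℓ).EA 0` with node-U3 fading memory + the (D4) clause `KernelDecayOfRecord₁₃Ax θ 0 1 κ` ⟹ box, θ-generic); §2 at the
RE-CENTRED Z3 members: `absBoxZBAxAt_of_runAbsBoxZB_of_kernelLetters` (a door's run letter + kernel letters ⟹ the door's box) and ★★★ `tokenFreeZBAx_of_runwiseZBAx_of_kernelLettersAt` (the
Ax RUN-WISE CORE — the `run` binder of ✓p808714 `K0V23Stub3RunwiseSuppliersAx.k0Body_of_runwiseZB_byName` — + kernel letters at one member per `(a₀, ε₂₉)` ⟹ the Ax BOX CORE — the `box`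
binder of ✓p807776 `K0V23Stub3SocketsAx.record13SepCoPHInhabitedAx_of_tokenFreeZB_byName`, window `min γ₀ ½`).  With the bare §5 (`exists_hbeta_runAbs_not_box`): NOT without letters.

HONEST FRAMING (binding).  Elementary real bookkeeping + by-name composition; the run letter, kernel-currency NE9 with fading memory and the (D4) clause are DISPLAYED HYPOTHESES inhabited
nowhere (NODE O ∕ N22 ∕ (D4) desks' letters; NE9 in kernel currency NOT printed for d = 4; [I] §1 p.264 «uniformly bounded» STATED, proof unpublished); nothing of Bałaban asserted or
discharged; NO β estimate; stub 3ᴬ′ᴮ NOT proved; K0ᴬ stmt-QuantumFields-27238 NOT closed; K1ᴬ ∕ K3ᴬ OPEN; K0⁷ 20541 aside, untouched; N07 NOT discharged; COUNT 8∕28 · K 1∕4 UNMOVED;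
R4 = the CONDITIONAL finite-𝕋⁴ rung `BalabanLadder.UV` at fixed `ε = L^(−K)` only — NOT continuum ∕ ℝ⁴ ∕ OS; the Yang–Mills mass gap (Clay) is NOT proved by any of this.
-/

noncomputable section

open scoped Matrix.Norms.L2Operator BigOperators
open Finset

namespace Summit.QuantumFields.YangMills.Theorems.K0V23Stub3RunBoxEquivalenceAx

open Literature.MathematicalPhysics.QuantumFieldTheory.Balaban1983to89
open Literature.MathematicalPhysics.QuantumFieldTheory.Balaban1983to89.Node00
open Literature.MathematicalPhysics.QuantumFieldTheory.Balaban1983to89.T4Continuum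
open Literature.MathematicalPhysics.QuantumFieldTheory.Balaban1983to89.FlowStep
open Literature.MathematicalPhysics.QuantumFieldTheory.Balaban1983to89.FlowStepRuns
open Literature.MathematicalPhysics.QuantumFieldTheory.Balaban1983to89.T4OutputRate (Window NE9)
open Literature.MathematicalPhysics.QuantumFieldTheory.Balaban1983to89.T4CouplingMatching (HistLipschitz)
open Literature.MathematicalPhysics.QuantumFieldTheory.Balaban1983to89.B12Sec2to5 (betaPrime510)
open Literature.MathematicalPhysics.QuantumFieldTheory.Balaban1983to89.Node00.U3OfKernels (objectsOfRecord₁₃Ax KernelDecayOfRecord₁₃Ax)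
open YMDAG.N22.AtKernels (histLipschitz_betaOfMerged_of_ne9 fadingMemory_histModuli_of_fadingMemory)
open Summit.QuantumFields.YangMills.Theorems.K0V23Stub3RunwiseSuppliers (runAbsBound_mono)
open Summit.QuantumFields.YangMills.Theorems.K0V23Stub3RunBoxEquivalence (absBetaBox_of_runAbsBound_of_histLipschitz)

/-! ## §0  Private helper (centre-free, re-homed verbatim; №366 R2) -/
section Helper

/-- Fading memory ⟹ k-summable rows (re-homed `private`): `0 ≤ Λ k i ≤ C·ω^{k−i}`, `0 ≤ ω < 1` ⟹ `Σ_{i ≤ k} Λ k i ≤ C/(1−ω)`. [folklore] -/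
private theorem sum_histModuli_le_of_fadingMemory' {C ω : ℝ} {Λ : ℕ → ℕ → ℝ} (h : T4CouplingMatching.FadingMemory C ω Λ) (hω0 : 0 ≤ ω) (hω1 : ω < 1) (k : ℕ) :
    ∑ i : Fin (k + 1), Λ k i ≤ C / (1 - ω) := by
  have hC : 0 ≤ C := by have := h k k le_rfl; simpa using this.1.trans this.2
  have h1 : ∑ i : Fin (k + 1), Λ k i ≤ ∑ i : Fin (k + 1), C * ω ^ (k - (i : ℕ)) :=
    Finset.sum_le_sum fun i _ => (h k i (Nat.lt_succ_iff.mp i.isLt)).2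
  have h2 : ∑ i : Fin (k + 1), C * ω ^ (k - (i : ℕ)) = C * ∑ j ∈ range (k + 1), ω ^ j := by
    rw [← Finset.mul_sum, Fin.sum_univ_eq_sum_range (fun i => ω ^ (k - i)) (k + 1), ← Finset.sum_range_reflect (fun j => ω ^ j) (k + 1)]
    congr 1
  have h3 : ∑ j ∈ range (k + 1), ω ^ j ≤ 1 / (1 - ω) := by
    have := geom_sum_Ico_le_of_lt_one (m := 0) (n := k + 1) hω0 hω1
    rw [pow_zero, ← Finset.range_eq_Ico] at this
    exact this
  calc ∑ i : Fin (k + 1), Λ k i ≤ C * ∑ j ∈ range (k + 1), ω ^ j := h1.trans_eq h2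
    _ ≤ C * (1 / (1 - ω)) := mul_le_mul_of_nonneg_left h3 hC
    _ = C / (1 - ω) := by ring

end Helper

/-! ## §1  θ-generic at the RE-CENTRED record: the run letter + N22's kernel NE9 (fading memory) + the (D4) letter ⟹ the sign-free BOX of `betaOfRecord₁₃ θ` (dag-n22-w3's road, generic row at the Ax term family) -/
section Record

variable (F : T4Family) (N : ℕ) [NeZero N]

/-- **(iii₀) THE SIGN-FREE BOX OF THE β OF RECORD FROM ITS RUN LETTER AND node U2's HISTORY-MODULI LETTER WITH FADING MEMORY** (any `θ`, `0 < γ₀ ≤ θ.γ`): the K2-side currency —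
`HistLipschitz Λ′ θ.γ (betaOfRecord₁₃ θ)` with `T4CouplingMatching.FadingMemory C ω Λ′`, `0 ≤ ω < 1` — plus the run letter (dag-n07-w3's currency) give the box with bound
`β′ + γ₀·C∕(1−ω)`.  CONDITIONAL; nothing asserted. [cite: Balaban1987RG1, §1 p.264, Thm 3 p.264 (bookkeeping)] -/
theorem absBetaBox_betaOfRecord₁₃Ax_of_runAbs_of_histLipschitz (θ : Stage13Params F N) {C ω β' γ₀ : ℝ} {Λ' : ℕ → ℕ → ℝ}
    (hL : HistLipschitz Λ' θ.γ (betaOfRecord₁₃Ax F N θ)) (hΛ : T4CouplingMatching.FadingMemory C ω Λ') (hω0 : 0 ≤ ω) (hω1 : ω < 1) (hγ₀ : 0 < γ₀) (hle : γ₀ ≤ θ.γ)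
    (hrun : ∀ (n : ℕ) (gs : ℕ → ℝ), RGEqH n (betaOfRecord₁₃Ax F N θ) gs → Step.InInterval γ₀ n gs → ∀ k, k ≤ n → |betaOfRecord₁₃Ax F N θ k (prefixOf gs k)| ≤ β') :
    BetaLowerH (-(β' + γ₀ * (C / (1 - ω)))) γ₀ (betaOfRecord₁₃Ax F N θ) ∧ BetaUpperH (β' + γ₀ * (C / (1 - ω))) γ₀ (betaOfRecord₁₃Ax F N θ) :=
  absBetaBox_of_runAbsBound_of_histLipschitz hγ₀ hrun hle hL (fun k i => (hΛ k i (Nat.lt_succ_iff.mp i.isLt)).1)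
    (sum_histModuli_le_of_fadingMemory' hΛ hω0 hω1)

/-- **★★ (iii) THE SIGN-FREE BOX OF THE β OF RECORD FROM ITS RUN LETTER AND THE K3∕N22 KERNEL LETTERS** (any `θ : Stage13Params F N`, window `0 < γ₀ ≤ θ.γ`): N22's kernel-currency
NE9 of the functional of record with moduli `Λ` having node-U3 fading memory `FadingMemory C₉ ω Λ` (`0 ≤ ω < 1`), the (D4) letter `KernelDecayOfRecord₁₃Ax F N θ 0 1 κ` (`0 < κ`) —
whence `HistLipschitz (β′₅₁₀(1,κ)·Λ (k+1) i) θ.γ (betaOfRecord₁₃ θ)` (dag-n22-w3's GENERIC `histLipschitz_betaOfMerged_of_ne9` at the re-centred term family) with rows summing to `≤ β′₅₁₀(1,κ)·C₉·ω∕(1−ω)` — and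
the RUN letter (dag-n07-w3's currency) give `−B ≤ β₁₃ᴬˣ(θ) ≤ B` on `]0, γ₀]^{k+1}`, all `k`, with `B = β′ + γ₀·(β′₅₁₀(1,κ)·C₉·ω∕(1−ω))`.  CONDITIONAL on the three displayed letters;
nothing of Bałaban asserted. [cite: Balaban1987RG1, (1.20)–(1.22) p.264, §1 p.264, (5.10) p.293, Thm 3 p.264; Balaban1988RG2Cluster, (2.13)–(2.14) pp.14–15] -/
theorem absBetaBox_betaOfRecord₁₃Ax_of_runAbs_of_kernelNE9 (θ : Stage13Params F N) (ℓ : U3Letters₁₁) {κ C₉ ω β' γ₀ : ℝ} {Λ : ℕ → ℕ → ℝ} (hκ : 0 < κ)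
    (h9 : NE9 ((objectsOfRecord₁₃Ax F N θ ℓ).EA 0) (Window θ.γ) κ Λ) (hdec : KernelDecayOfRecord₁₃Ax F N θ 0 1 κ)
    (hΛ : T4OutputRate.FadingMemory C₉ ω Λ) (hω0 : 0 ≤ ω) (hω1 : ω < 1) (hγ₀ : 0 < γ₀) (hle : γ₀ ≤ θ.γ)
    (hrun : ∀ (n : ℕ) (gs : ℕ → ℝ), RGEqH n (betaOfRecord₁₃Ax F N θ) gs → Step.InInterval γ₀ n gs → ∀ k, k ≤ n → |betaOfRecord₁₃Ax F N θ k (prefixOf gs k)| ≤ β') :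
    BetaLowerH (-(β' + γ₀ * (betaPrime510 4 1 κ * C₉ * ω / (1 - ω)))) γ₀ (betaOfRecord₁₃Ax F N θ) ∧
      BetaUpperH (β' + γ₀ * (betaPrime510 4 1 κ * C₉ * ω / (1 - ω))) γ₀ (betaOfRecord₁₃Ax F N θ) := by
  have hL : HistLipschitz (fun k i => betaPrime510 4 1 κ * Λ (k + 1) i) θ.γ (betaOfRecord₁₃Ax F N θ) := by
    letI := θ.instVβ₁; letI := θ.instVβ₂; letI := θ.instιβ
    exact histLipschitz_betaOfMerged_of_ne9 F _ θ.ρ8 θ.bV hκ h9 hdec _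
  -- `0 ≤ β′₅₁₀(1, κ)` (a `tsum` of non-negative terms, inlined to keep the import cone small)
  have hP : 0 ≤ betaPrime510 4 1 κ := by
    unfold betaPrime510
    rw [one_mul]
    exact tsum_nonneg fun x => mul_nonneg (sq_nonneg _) (Real.exp_nonneg _)
  have hFM := fadingMemory_histModuli_of_fadingMemory hP hΛ
  exact absBetaBox_of_runAbsBound_of_histLipschitz hγ₀ hrun hle hL (fun k i => (hFM k i (Nat.lt_succ_iff.mp i.isLt)).1)
    (sum_histModuli_le_of_fadingMemory' hFM hω0 hω1)

end Record

/-! ## §2  At the RE-CENTRED print-regime Z3 members `θ₁₃ᶜᶜᴹᵂᶻᴮ·ᴬˣ(j; ½; εbg; …)` (`.γ = ½`): the run letter + the kernel letters ⟹ the door's box; the run CORE + kernel letters ⟹ the BOX CORE -/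
section ZB

/-- **★★ A DOOR's RUN LETTER + THE KERNEL LETTERS AT THE HALF-WINDOW MEMBER ⟹ THE DOOR's BOX**: ✓p808714 `…RunwiseSuppliersAx` §3's `h3R` (some `γ₀, ε₀, ε₂₉ > 0`, `β′` with the run letter of
`β₁₃(θ₁₃ᶜᶜᴹᵂᶻᴮ·ᴬˣ(j; ½; εbg; ε₀, ε₂₉; …))`) and — at that member — SOME letter block `ℓ`, rate `κ > 0`, moduli `Λ` with node-U3 fading memory `(C₉, ω)`, `0 ≤ ω < 1`, carrying N22's
kernel NE9 on `Window ½` and the (D4) letter, for every pair of thresholds, give `…ZBLamAx` §4's box hypothesis `h3A` at the same door (window `min γ₀ ½`, §3).  So under the kernel letters the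
run socket and the box socket of a door are ONE debt.  CONDITIONAL; nothing of Bałaban asserted. [cite: Balaban1987RG1, Thm 1 p.259, (1.20)–(1.22) p.264, §1 p.264, Thm 3 p.264, (5.10) p.293; Balaban1988Convergent, Thm 1 p.262] -/
theorem absBoxZBAxAt_of_runAbsBoxZB_of_kernelLetters (F : T4Family) {j : ℕ} {εbg B₃ B₃' a₀ a₁ : ℝ} {Efl logz : B12.RunParams → ℕ → ℝ}
    (h3R : ∃ γ₀ ε₀ ε₂₉ β' : ℝ, 0 < γ₀ ∧ 0 < ε₀ ∧ 0 < ε₂₉ ∧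
      ∀ (n : ℕ) (gs : ℕ → ℝ), RGEqH n (betaOfRecord₁₃Ax F 2 (theta13OfThm1CCMWZBAx F 2 j (1 / 2) εbg ε₀ ε₂₉ B₃ B₃' a₀ a₁ Efl logz)) gs → Step.InInterval γ₀ n gs →
        ∀ k, k ≤ n → |betaOfRecord₁₃Ax F 2 (theta13OfThm1CCMWZBAx F 2 j (1 / 2) εbg ε₀ ε₂₉ B₃ B₃' a₀ a₁ Efl logz) k (prefixOf gs k)| ≤ β')
    (hK : ∀ (ε₀ ε₂₉ : ℝ), 0 < ε₀ → 0 < ε₂₉ →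
      ∃ (ℓ : U3Letters₁₁) (κ C₉ ω : ℝ) (Λ : ℕ → ℕ → ℝ), 0 < κ ∧ 0 ≤ ω ∧ ω < 1 ∧
        NE9 ((objectsOfRecord₁₃Ax F 2 (theta13OfThm1CCMWZBAx F 2 j (1 / 2) εbg ε₀ ε₂₉ B₃ B₃' a₀ a₁ Efl logz) ℓ).EA 0)
          (Window (theta13OfThm1CCMWZBAx F 2 j (1 / 2) εbg ε₀ ε₂₉ B₃ B₃' a₀ a₁ Efl logz).γ) κ Λ ∧
        KernelDecayOfRecord₁₃Ax F 2 (theta13OfThm1CCMWZBAx F 2 j (1 / 2) εbg ε₀ ε₂₉ B₃ B₃' a₀ a₁ Efl logz) 0 1 κ ∧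
        T4OutputRate.FadingMemory C₉ ω Λ) :
    ∃ γ₀ ε₀ ε₂₉ β' : ℝ, 0 < γ₀ ∧ 0 < ε₀ ∧ 0 < ε₂₉ ∧
      BetaLowerH (-β') γ₀ (betaOfRecord₁₃Ax F 2 (theta13OfThm1CCMWZBAx F 2 j (1 / 2) εbg ε₀ ε₂₉ B₃ B₃' a₀ a₁ Efl logz)) ∧
      BetaUpperH β' γ₀ (betaOfRecord₁₃Ax F 2 (theta13OfThm1CCMWZBAx F 2 j (1 / 2) εbg ε₀ ε₂₉ B₃ B₃' a₀ a₁ Efl logz)) := by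
  obtain ⟨γ₀, ε₀, ε₂₉, β', hγ₀, hε, hε', hrun⟩ := h3R
  obtain ⟨ℓ, κ, C₉, ω, Λ, hκ, hω0, hω1, h9', hdec, hΛ⟩ := hK ε₀ ε₂₉ hε hε'
  set γ₁ : ℝ := min γ₀ (1 / 2) with hγ₁
  have hγ₁pos : 0 < γ₁ := lt_min hγ₀ (by norm_num)
  have hγ₁le : γ₁ ≤ (theta13OfThm1CCMWZBAx F 2 j (1 / 2) εbg ε₀ ε₂₉ B₃ B₃' a₀ a₁ Efl logz).γ := by rw [theta13OfThm1CCMWZBAx_γ]; exact min_le_right _ _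
  obtain ⟨hlow, hup⟩ := absBetaBox_betaOfRecord₁₃Ax_of_runAbs_of_kernelNE9 F 2 _ ℓ hκ h9' hdec hΛ hω0 hω1 hγ₁pos hγ₁le (runAbsBound_mono (min_le_left _ _) hrun)
  exact ⟨γ₁, ε₀, ε₂₉, _, hγ₁pos, hε, hε', hlow, hup⟩

/-- Letter census (`rfl`; = ✓p807776 `K0V23Stub3SocketsAx.betaOfRecord₁₃_zbRegime_letterBlind`, `private` to stay route-independent): β at the print-regime member reads only `(a₀, ε₂₉)`. [cite: Balaban1987RG1, (1.20)–(1.22) p.264, (2.9) p.266 (bookkeeping)] -/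
private theorem census (F : T4Family) (j j' : ℕ) (a₀ ε₀ ε₀' ε₂₉ B₃ C₃ B₃' C₃' a₁ c₁ : ℝ) (Efl logz Efl' logz' : B12.RunParams → ℕ → ℝ) :
    betaOfRecord₁₃Ax F 2 (theta13OfThm1CCMWZBAx F 2 j (1 / 2) a₀ ε₀ ε₂₉ B₃ B₃' a₀ a₁ Efl logz) =
      betaOfRecord₁₃Ax F 2 (theta13OfThm1CCMWZBAx F 2 j' (1 / 2) a₀ ε₀' ε₂₉ C₃ C₃' a₀ c₁ Efl' logz') := rfl

/-- **★★★ THE RUN-WISE CORE + THE KERNEL LETTERS AT ONE MEMBER PER `(a₀, ε₂₉)` ⟹ THE BOX CORE** — the converse of ✓p808714 `K0V23Stub3RunwiseSuppliersAx.runwiseZB_of_tokenFreeZB` modulo the K3∕N22 letters: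
dag-n07-w3's run core «∀ a₀ > 0, ∃ γ₀ ε₂₉ β′, run letter of β₁₃(F; a₀, ε₂₉) at level γ₀» together with, for every radius `a₀ > 0` and threshold `ε₂₉ > 0`, the kernel letters
(NE9 on `Window ½` + (D4) + fading memory) at SOME print-regime member `θ₁₃ᶜᶜᴹᵂᶻᴮ·ᴬˣ(j; ½; a₀; ε₀, ε₂₉; B₃, B₃′, a₀, a₁; Efl, logz)` (any letters — β is blind to them, census) gives the
BOX core of ✓p807776∕p811281 (`tokenFreeZB` at Ax: «∀ a₀ > 0, ∃ γ₀ ε₂₉ β′, the sign-free box of β₁₃(F; a₀, ε₂₉) on ]0, γ₀]»), window `min γ₀ ½`.  CONDITIONAL on both displayed inputs;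
stub 3ᴬ′ᴮ NOT proved; nothing of Bałaban asserted. [cite: Balaban1987RG1, Thm 3 p.264, §1 p.264, (1.20)–(1.22) p.264, (5.10) p.293; Balaban1988RG2Cluster, (2.13)–(2.14) pp.14–15] -/
theorem tokenFreeZBAx_of_runwiseZBAx_of_kernelLettersAt (F : T4Family)
    (run : ∀ a₀ : ℝ, 0 < a₀ → ∃ γ₀ ε₂₉ β' : ℝ, 0 < γ₀ ∧ 0 < ε₂₉ ∧ ∀ (j : ℕ) (ε₀ B₃ B₃' a₁ : ℝ),
      ∀ (n : ℕ) (gs : ℕ → ℝ), RGEqH n (betaOfRecord₁₃Ax F 2 (theta13OfThm1CCMWZBAx F 2 j (1 / 2) a₀ ε₀ ε₂₉ B₃ B₃' a₀ a₁ (fun _ _ => 0) (fun _ _ => 0))) gs → Step.InInterval γ₀ n gs →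
        ∀ k, k ≤ n → |betaOfRecord₁₃Ax F 2 (theta13OfThm1CCMWZBAx F 2 j (1 / 2) a₀ ε₀ ε₂₉ B₃ B₃' a₀ a₁ (fun _ _ => 0) (fun _ _ => 0)) k (prefixOf gs k)| ≤ β')
    (hK : ∀ (a₀ ε₂₉ : ℝ), 0 < a₀ → 0 < ε₂₉ →
      ∃ (j : ℕ) (ε₀ B₃ B₃' a₁ : ℝ) (Efl logz : B12.RunParams → ℕ → ℝ) (ℓ : U3Letters₁₁) (κ C₉ ω : ℝ) (Λ : ℕ → ℕ → ℝ), 0 < κ ∧ 0 ≤ ω ∧ ω < 1 ∧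
        NE9 ((objectsOfRecord₁₃Ax F 2 (theta13OfThm1CCMWZBAx F 2 j (1 / 2) a₀ ε₀ ε₂₉ B₃ B₃' a₀ a₁ Efl logz) ℓ).EA 0)
          (Window (theta13OfThm1CCMWZBAx F 2 j (1 / 2) a₀ ε₀ ε₂₉ B₃ B₃' a₀ a₁ Efl logz).γ) κ Λ ∧
        KernelDecayOfRecord₁₃Ax F 2 (theta13OfThm1CCMWZBAx F 2 j (1 / 2) a₀ ε₀ ε₂₉ B₃ B₃' a₀ a₁ Efl logz) 0 1 κ ∧
        T4OutputRate.FadingMemory C₉ ω Λ) :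
    ∀ a₀ : ℝ, 0 < a₀ → ∃ γ₀ ε₂₉ β' : ℝ, 0 < γ₀ ∧ 0 < ε₂₉ ∧ ∀ (j : ℕ) (ε₀ B₃ B₃' a₁ : ℝ),
      BetaLowerH (-β') γ₀ (betaOfRecord₁₃Ax F 2 (theta13OfThm1CCMWZBAx F 2 j (1 / 2) a₀ ε₀ ε₂₉ B₃ B₃' a₀ a₁ (fun _ _ => 0) (fun _ _ => 0))) ∧
      BetaUpperH β' γ₀ (betaOfRecord₁₃Ax F 2 (theta13OfThm1CCMWZBAx F 2 j (1 / 2) a₀ ε₀ ε₂₉ B₃ B₃' a₀ a₁ (fun _ _ => 0) (fun _ _ => 0))) := by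
  intro a₀ ha₀
  obtain ⟨γ₀, ε₂₉, β', hγ₀, hε', hall⟩ := run a₀ ha₀
  obtain ⟨j, ε₀, B₃, B₃', a₁, Efl, logz, ℓ, κ, C₉, ω, Λ, hκ, hω0, hω1, h9', hdec, hΛ⟩ := hK a₀ ε₂₉ ha₀ hε'
  set γ₁ : ℝ := min γ₀ (1 / 2) with hγ₁
  have hγ₁pos : 0 < γ₁ := lt_min hγ₀ (by norm_num)
  have hγ₁le : γ₁ ≤ (theta13OfThm1CCMWZBAx F 2 j (1 / 2) a₀ ε₀ ε₂₉ B₃ B₃' a₀ a₁ Efl logz).γ := by rw [theta13OfThm1CCMWZBAx_γ]; exact min_le_right _ _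
  have hrun : ∀ (n : ℕ) (gs : ℕ → ℝ), RGEqH n (betaOfRecord₁₃Ax F 2 (theta13OfThm1CCMWZBAx F 2 j (1 / 2) a₀ ε₀ ε₂₉ B₃ B₃' a₀ a₁ Efl logz)) gs → Step.InInterval γ₁ n gs →
      ∀ k, k ≤ n → |betaOfRecord₁₃Ax F 2 (theta13OfThm1CCMWZBAx F 2 j (1 / 2) a₀ ε₀ ε₂₉ B₃ B₃' a₀ a₁ Efl logz) k (prefixOf gs k)| ≤ β' := by
    rw [← census F 0 j a₀ a₀ ε₀ ε₂₉ 0 B₃ 0 B₃' a₀ a₁ (fun _ _ => 0) (fun _ _ => 0) Efl logz]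
    exact runAbsBound_mono (min_le_left _ _) (hall 0 a₀ 0 0 a₀)
  obtain ⟨hlow, hup⟩ := absBetaBox_betaOfRecord₁₃Ax_of_runAbs_of_kernelNE9 F 2 _ ℓ hκ h9' hdec hΛ hω0 hω1 hγ₁pos hγ₁le hrun
  refine ⟨γ₁, ε₂₉, β' + γ₁ * (betaPrime510 4 1 κ * C₉ * ω / (1 - ω)), hγ₁pos, hε', fun j' ε₀' C₃ C₃' c₁' => ?_⟩
  rw [census F j' j a₀ ε₀' ε₀ ε₂₉ C₃ B₃ C₃' B₃' c₁' a₁ (fun _ _ => 0) (fun _ _ => 0) Efl logz]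
  exact ⟨hlow, hup⟩

end ZB


end Summit.QuantumFields.YangMills.Theorems.K0V23Stub3RunBoxEquivalenceAx

end
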